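import Summits.CriticalPhenomena.PercolationContinuityZ3.Theorems.Transplant.LineGraphSiteContinuity
import Summits.CriticalPhenomena.PercolationContinuityZ3.Theorems.Transplant.AutCylinderWolf
import Summits.CriticalPhenomena.PercolationContinuityZ3.Theorems.Transplant.AutProperVirtuallyNilpotent
import HarnessLib

/-!
# SITE percolation on the line graphs of the class-C2 graphs of rung Q: Benjamini–Schramm's Conjecture 4 IN ITS SITE FORM on `L(Cay(Γ; S))` for every
# finitely generated virtually nilpotent `Γ`, and on `L(X)` for every cocompact finite-stabiliser virtually nilpotent action — by p2's Fisher–Essam device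

builds on p205010 (kernel theorem, internal audit signed; external expert review pending).  Lane `prim-bschramm`, seat `prim-bschramm-gen-5` gen 3, lead g24 (offer (B′)).
Helper file (`--supports stmt-CriticalPhenomena-4575 --as helper`); PROOFS ONLY (def-free); two-line customers, no new device; NOTHING is claimed about any open
node and no 'closed' wording is used.

THE DEVICE (p2 gen 13, «Literature/Probability/Percolation/LineGraphPercolation» + «Transplant/LineGraphSiteContinuity»; Fisher–Essam 1961 / Kesten 1982 Prop. 3.1):
Bernoulli SITE percolation on the line graph `L(G) = G.lineGraph` IS Bernoulli BOND percolation on `G`: `p_c^{site}(L(G), e) = p_c(G, v)` for every end-vertex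
`v` of `e` (`siteCriticalProb_lineGraph_eq`) and bond continuity at `v` gives site continuity at `e` (`lineGraph_siteCriticalContinuity_at`).  p2's catalogue
(«LineGraphSiteCustomers») pushed the lane's C1b bond rows through it (ℤ^d, pyrochlore, fcc/bcc, cds, sqp, kagomé, stacked triangular, the Heisenberg Cayley
graph).  THIS FILE pushes the class-C2 rows of rung Q through it, in the BODY SHAPE of `BenjaminiSchramm1996_conj4_site`
(`… → p_c^{site} < 1 → θ^{site}(p_c^{site}) = 0`, the `p_c^{site} < 1` hypothesis transported to `p_c < 1` at an end-vertex):
* `lineGraph_site_conj4_cayley_virtuallyNilpotent` — the line graph of EVERY Cayley graph `Cay(Γ; S)` of EVERY finitely generated VIRTUALLY NILPOTENT group, on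
  every finite generating set (over p3 g31's hpoly-free `AutCyl.conj4_cayley_virtuallyNilpotent`, p560483); Mathlib-predicate form `…_of_isVirtuallyNilpotent`;
* `lineGraph_site_conj4_of_virtuallyNilpotent_of_stabilizers_finite` — the line graph of every connected locally finite graph carrying a cocompact action with
  FINITE vertex stabilisers by automorphisms of a virtually nilpotent group (over gen-5 g3's `AutCyl.conj4_of_virtuallyNilpotent_of_stabilizers_finite`, p563737),
  and the hypothesis-free form `…_of_not_virtuallyCyclic` (`p_c^{site}(L(X), e) < 1` itself follows when the group is not virtually cyclic).
These line graphs are quasi-transitive (p2's `lineGraph_isQuasiTransitive`) and in general NOT Cayley graphs; none of the site statements is in print.  What is NOT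
here: general quasi-transitive polynomial growth (stays modulo Trofimov on the bond side, hence here too); site percolation on the C2 graphs THEMSELVES (the device
goes bond → site on the LINE graph only; Grimmett 1999 §1.6: the converse transformation does not exist).
[cite: FisherEssam1961, §2] [cite: Kesten1982, §2.5 and §3.1 Prop. 3.1] [cite: BenjaminiSchramm1996, Conj. 4; §2 (almost transitive graphs)] [cite: WolfGrowth1968, Thm. 3.2]
-/

noncomputable section

namespace Summit.CriticalPhenomena.PercolationContinuityZ3.Theorems.Transplant

open SimpleGraph Literature.Barriers.CriticalPhenomena Literature.Probability.LatticeModels Literature.Probability.Percolation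
open scoped Classical

namespace AutCyl

/-! ## §1 Line graphs of Cayley graphs of virtually nilpotent groups -/

/-- **Conjecture 4 (SITE form) on the line graph of every Cayley graph of every finitely generated VIRTUALLY NILPOTENT group**: for `Γ` with a nilpotent
subgroup `N` of finite index and a finite generating set `S`, at every vertex `e` (a bond of `Cay(Γ; S)`) of the line graph with `p_c^{site} < 1`,
`θ^{site}_e(p_c^{site}) = 0` — Fisher–Essam transport of `conj4_cayley_virtuallyNilpotent` (no growth hypothesis, no named fact).  builds on p205010 (kernel theorem,
internal audit signed; external expert review pending). [cite: BenjaminiSchramm1996, Conj. 4; §2] [cite: Kesten1982, §3.1 Prop. 3.1] [cite: WolfGrowth1968, Thm. 3.2] -/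
theorem lineGraph_site_conj4_cayley_virtuallyNilpotent {Γ : Type} [Group Γ] (S : Finset Γ) (hS : Subgroup.closure (S : Set Γ) = ⊤)
    (N : Subgroup Γ) [N.FiniteIndex] [Group.IsNilpotent N] (e : (mulCayley (↑S : Set Γ)).edgeSet)
    (he : siteCriticalProb (mulCayley (↑S : Set Γ)).lineGraph e < 1) :
    siteTheta (mulCayley (↑S : Set Γ)).lineGraph e (siteCriticalProbIOf (mulCayley (↑S : Set Γ)).lineGraph e) = 0 := by
  have hg : (e : Sym2 Γ).out.1 ∈ (e : Sym2 Γ) := Sym2.out_fst_mem _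
  haveI : Countable Γ :=
    countable_of_connected_of_locallyFinite (mulCayley (↑S : Set Γ)) (CayleyScaled.connected_mulCayley_of_closure S hS) (e : Sym2 Γ).out.1
  have hpc : criticalProb (mulCayley (↑S : Set Γ)) (e : Sym2 Γ).out.1 < 1 := by rwa [siteCriticalProb_lineGraph_eq e hg] at he
  exact lineGraph_siteCriticalContinuity_at e hg (conj4_cayley_virtuallyNilpotent S hS N _ hpc)

/-- **The same over Mathlib's predicate `Group.IsVirtuallyNilpotent Γ`.**  builds on p205010 (kernel theorem, internal audit signed; external expert review pending).
[cite: BenjaminiSchramm1996, Conj. 4; §2] [cite: Kesten1982, §3.1 Prop. 3.1] -/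
theorem lineGraph_site_conj4_cayley_of_isVirtuallyNilpotent {Γ : Type} [Group Γ] (hΓ : Group.IsVirtuallyNilpotent Γ) (S : Finset Γ)
    (hS : Subgroup.closure (S : Set Γ) = ⊤) (e : (mulCayley (↑S : Set Γ)).edgeSet) (he : siteCriticalProb (mulCayley (↑S : Set Γ)).lineGraph e < 1) :
    siteTheta (mulCayley (↑S : Set Γ)).lineGraph e (siteCriticalProbIOf (mulCayley (↑S : Set Γ)).lineGraph e) = 0 := by
  obtain ⟨N, hN, hfi⟩ := hΓ
  haveI := hN
  haveI := hfi
  exact lineGraph_site_conj4_cayley_virtuallyNilpotent S hS N e he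

/-! ## §2 Line graphs of graphs with a cocompact finite-stabiliser virtually nilpotent action -/

section Proper

variable {W : Type} {X : SimpleGraph W} {A : Type} [Group A] [MulAction A W] [X.LocallyFinite]

/-- **Conjecture 4 (SITE form) on the line graph of every connected locally finite graph carrying a cocompact action with FINITE vertex stabilisers by automorphisms
of a virtually nilpotent group** (clause (ii)′ transported by Fisher–Essam): at every vertex `e` of `L(X)` with `p_c^{site} < 1`, `θ^{site}_e(p_c^{site}) = 0`.  builds on
p205010 (kernel theorem, internal audit signed; external expert review pending). [cite: BenjaminiSchramm1996, Conj. 4; §2 (almost transitive graphs)] [cite: Kesten1982, §3.1 Prop. 3.1] -/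
theorem lineGraph_site_conj4_of_virtuallyNilpotent_of_stabilizers_finite (hc : X.Connected) (hact : IsActionByAut X A) (reps : Finset W)
    (hcover : ∀ w : W, ∃ a : A, ∃ r ∈ reps, a • r = w) (hfin : ∀ r ∈ reps, (MulAction.stabilizer A r : Set A).Finite)
    (N : Subgroup A) [N.FiniteIndex] [Group.IsNilpotent N] (e : X.edgeSet) (he : siteCriticalProb X.lineGraph e < 1) :
    siteTheta X.lineGraph e (siteCriticalProbIOf X.lineGraph e) = 0 := by
  have hx : (e : Sym2 W).out.1 ∈ (e : Sym2 W) := Sym2.out_fst_mem _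
  haveI : Countable W := countable_of_connected_of_locallyFinite X hc (e : Sym2 W).out.1
  have hpc : criticalProb X (e : Sym2 W).out.1 < 1 := by rwa [siteCriticalProb_lineGraph_eq e hx] at he
  exact lineGraph_siteCriticalContinuity_at e hx (conj4_of_virtuallyNilpotent_of_stabilizers_finite hc hact reps hcover hfin N _ hpc)

/-- **Hypothesis-free form (Conjectures 1 + 4, SITE, on the line graph)**: if the virtually nilpotent group is NOT virtually cyclic then `p_c^{site}(L(X), e) < 1` AND
`θ^{site}_e(p_c^{site}) = 0` at every vertex `e` of the line graph (the bond dichotomy at an end-vertex, transported).  builds on p205010 (kernel theorem, internal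
audit signed; external expert review pending). [cite: BenjaminiSchramm1996, §2 Conj. 1, Conj. 4] [cite: Kesten1982, §3.1 Prop. 3.1] -/
theorem lineGraph_site_conj4_of_virtuallyNilpotent_of_stabilizers_finite_of_not_virtuallyCyclic (hc : X.Connected) (hact : IsActionByAut X A)
    (reps : Finset W) (hcover : ∀ w : W, ∃ a : A, ∃ r ∈ reps, a • r = w) (hfin : ∀ r ∈ reps, (MulAction.stabilizer A r : Set A).Finite)
    (N : Subgroup A) [N.FiniteIndex] [Group.IsNilpotent N] (hnvc : ¬ ∃ c : A, (Subgroup.zpowers c).FiniteIndex) (e : X.edgeSet) :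
    siteCriticalProb X.lineGraph e < 1 ∧ siteTheta X.lineGraph e (siteCriticalProbIOf X.lineGraph e) = 0 := by
  have hx : (e : Sym2 W).out.1 ∈ (e : Sym2 W) := Sym2.out_fst_mem _
  haveI : Countable W := countable_of_connected_of_locallyFinite X hc (e : Sym2 W).out.1
  have hpc := (conj4_of_virtuallyNilpotent_of_stabilizers_finite_of_not_virtuallyCyclic hc hact reps hcover hfin N hnvc (e : Sym2 W).out.1).1
  have he : siteCriticalProb X.lineGraph e < 1 := by rwa [siteCriticalProb_lineGraph_eq e hx]
  exact ⟨he, lineGraph_site_conj4_of_virtuallyNilpotent_of_stabilizers_finite hc hact reps hcover hfin N e he⟩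

end Proper

end AutCyl

end Summit.CriticalPhenomena.PercolationContinuityZ3.Theorems.Transplant

end
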